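import Summits.Ventures.PercRepro.S1TriangleVCount
import Summits.Ventures.PercRepro.S1FourCircuitW2
import Summits.Ventures.PercRepro.S1FiveCircuitX
import Summits.Ventures.PercRepro.S1CellCaps5

/-!
# PercRepro — the cell `(8, 22)` of the `q = 4` window, by LEMMAS V, W′ and X (p2, gen 18)

At `n = 30` LEMMA V gives `s₃ ≤ 100`, LEMMA W′ the curve `s₄ ≤ ⌊(24360 − 60·s₃)/8⌋` for the ACTUAL `s₃`, and LEMMA X
`s₅ ≤ 32886` (the chain's `C(26, 5) = 65780`). The three-cap cell inequality `cellOK14 8 22 s₃ S(s₃) 32886` holds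
for every `s₃ ≤ 100` (a kernel table of `101` cells; the twin's worst ratio `0.9583`), so the `e`-free cores of rank
`8` with `30` points satisfy `RLS` at level `4`.

* `cell_eight_twentytwo_table` — the `101` kernel cells;
* **`c025_core_eight_twentytwo`** — the core of rank `8` with `30` points.
Axioms: standard.
-/

open scoped Matroid

namespace PercRepro

namespace S1

open Set

variable {α : Type}

/-- The cells `(8, 22)` along LEMMA W′'s curve with LEMMA X's `s₅ ≤ 32886`: for every `s₃ ≤ 100`. -/
theorem cell_eight_twentytwo_table : ∀ P < 101, cellOK14 8 22 P ((24360 - 60 * P) / 8) 32886 = true := by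
  decide +kernel

/-- **THE CELL `(8, 22)`**: an `e`-free core of rank `8` with `30` points satisfies `RLS` at level `4`. -/
theorem c025_core_eight_twentytwo (M : Matroid α) [M.Finite] (hR : M.eRank = (8 : ℕ)) (hn : M.E.ncard = 30)
    (hfree : ∀ e ∈ M.E, ∃ A ⊆ M.E \ {e}, e ∉ M.closure A ∧ e ∉ M.closure ((M.E \ {e}) \ A)) :
    ThmN.RLS M 8 4 := by
  have hP : {C : Set α | M.IsCircuit C ∧ C.ncard = 3}.ncard ≤ 100 := by
    have h := core_ncard_triangles_le_sq_div_nine M hfree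
    rw [hn] at h
    exact h.trans (by norm_num)
  have hW := core_eight_mul_ncard_fourCircuits_add_le M hfree
  rw [hn] at hW
  have hS : {C : Set α | M.IsCircuit C ∧ C.ncard = 4}.ncard ≤
      (24360 - 60 * {C : Set α | M.IsCircuit C ∧ C.ncard = 3}.ncard) / 8 := by
    rw [Nat.le_div_iff_mul_le (by norm_num)]
    omega
  have hS5 : {C : Set α | M.IsCircuit C ∧ C.ncard = 5}.ncard ≤ 32886 := by
    have h := core_ncard_fiveCircuits_le_mul_div M hfree
    rw [hn] at h
    exact h.trans (by norm_num)
  exact rls_of_cellOK14 M 8 22 _ _ 32886 (by norm_num) hR hn hfree le_rfl hS hS5 (by norm_num)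
    (cell_eight_twentytwo_table _ (by omega))

end S1

end PercRepro
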